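import Summits.Schanuel.Schanuel.Theorems.ZilberEacBranchOneDirection
import HarnessLib

/-!
# Arbitrary base branches, LXXII: the growth / Kronecker DICHOTOMY — an IRRATIONAL phase
# coefficient excludes resonance, so finite nonzero fibre values are dense with NO transcendence
# input; equal pole orders with a real irrational direction

HONEST FRAMING.  Cell `pub-schanuel` (Zilber's Exponential-Algebraic Closedness, case ladder;
host summit Schanuel), seat 2, gen 32.  File II of this series
(`unprojectedDense_of_ramified_witness_abstract`) turns a ramified witness — exponential points
`q_j` of an irreducible surface `S` (`dim S ≤ 2`) with `‖x₀(q_j)‖ → ∞` and the EXACT identity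
`x₁(q_j) = Π(m₀ + j) + r(μ_j)` (`Π ∈ ℂ[X]`, `r` analytic at `0`, `μ_j → 0`) — into Zariski density by
the trichotomy GROWTH (`Re Π` non-constant: THEOREM G) / RESONANCE (periodic phases: THEOREM T,
which needs the transcendence hypothesis `htr`) / KRONECKER (a phase coefficient irrational: the
phases `e^{i Im Π(m)}` do not accumulate at a finite set, `urot_eval_not_near_finset`, while a
relation on all points would force them to, `phases_near_finset_of_relation`).  Only the resonant
branch uses `htr`.  Hence:
* **`unprojectedDense_of_witness_irrational_phase`** — if SOME coefficient `Π_j`, `j ≥ 1`, has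
  `Im Π_j / 2π` IRRATIONAL, the witness gives density with NO transcendence hypothesis (and no
  information on `x₀` beyond `‖x₀(q_j)‖ → ∞`);
* **`unprojectedDense_branch_of_irrational_phase`** — a cylinder germ
  `(s^{-k}, Φ(s)s^{-M}, ψ(s), e^{x₁})` (`k, M ≥ 1`, `ψ(0) ≠ 0`) in an irreducible closed `S` of
  dimension `≤ 2` is dense as soon as `Im(Φ(0)z^M)/2π` is irrational for SOME `k`-th root `z` of
  `2πi` (the top phase coefficient is `Π_M = Φ(0)z^M`, file XIV); with file XIX: dense unless
  `Φ(0)z^M ∈ 2πiℚ` for every root `z` (**`unprojectedDense_branch_of_not_resonant`**);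
* **`unprojectedDense_branch_unitFibre_irrational`** — EQUAL pole orders `M = k` and a REAL
  IRRATIONAL direction `Φ(0) = a`: `Π_k = 2πia`, so every such germ is dense, for every `k ≥ 1` —
  the case in which the growth mechanism is void (`Re x₁ = a Re x₀ + o(x₀)`, file XXXII: "nothing when
  `M = k`") and which the cell's real-line engines reach only for exact lines.
With file LXXI (pole / zero fibre values by THEOREM I) this settles, in file LXXIII, every
polynomial fibre over every irreducible plane curve with a simple real-irrational asymptotic
direction (e.g. the hyperbola `x₁² = 2x₀² + 1`).  Decided instances of an OPEN question
(Mantova–Masser, PLMS 2024 §1 p. 5); EC(3,2) OPEN; NOT Schanuel's conjecture (neither used nor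
implied); EAC ⇏ SC.
-/

noncomputable section

open Filter Topology Polynomial MvPolynomial Bornology Complex
open Literature.NumberTheory.Transcendental Literature.ModelTheory.Zilber
open Literature.ModelTheory.ExponentialFields

set_option linter.dupNamespace false

namespace Summit.Schanuel.Schanuel.Theorems

/-! ## Part A. Real and imaginary parts of the phase polynomial, with explicit coefficients -/

/-- **Real/imaginary split of a complex polynomial on `ℝ`, with the coefficients of the phase
polynomial**: `g_R = Σ Re(Q_j) X^j`, `g_I = Σ (Im(Q_j)/2π) X^j`, `Re Q(x) = g_R(x)`,
`exp(Q(x)) = e^{g_R(x)}·urot(g_I(x))` for real `x`, and `[X^j] g_I = Im(Q_j)/2π`. [folklore] -/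
theorem exists_re_im_polynomials_coeff (Q : ℂ[X]) : ∃ gR gI : ℝ[X],
    (∀ x : ℝ, (Q.eval (x : ℂ)).re = gR.eval x) ∧
    (∀ x : ℝ, Complex.exp (Q.eval (x : ℂ)) = (Real.exp (gR.eval x) : ℂ) * urot (gI.eval x)) ∧
    ∀ j, gI.coeff j = (Q.coeff j).im / (2 * Real.pi) := by
  classical
  set n := Q.natDegree + 1 with hn
  set gR : ℝ[X] := ∑ j ∈ Finset.range n, Polynomial.monomial j (Q.coeff j).re with hgR
  set gI : ℝ[X] := ∑ j ∈ Finset.range n, Polynomial.monomial j ((Q.coeff j).im / (2 * Real.pi))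
    with hgI
  have hre : ∀ x : ℝ, (Q.eval (x : ℂ)).re = gR.eval x := by
    intro x
    rw [Polynomial.eval_eq_sum_range, Complex.re_sum, hgR, Polynomial.eval_finsetSum]
    refine Finset.sum_congr rfl fun j _ => ?_
    rw [Polynomial.eval_monomial, ← Complex.ofReal_pow, Complex.re_mul_ofReal]
  have him : ∀ x : ℝ, (Q.eval (x : ℂ)).im = 2 * Real.pi * gI.eval x := by
    intro x
    rw [Polynomial.eval_eq_sum_range, Complex.im_sum, hgI, Polynomial.eval_finsetSum, Finset.mul_sum]
    refine Finset.sum_congr rfl fun j _ => ?_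
    rw [Polynomial.eval_monomial, ← Complex.ofReal_pow, Complex.im_mul_ofReal]
    field_simp
  refine ⟨gR, gI, hre, fun x => ?_, fun j => ?_⟩
  · conv_lhs => rw [← Complex.re_add_im (Q.eval (x : ℂ)), hre x, him x]
    rw [Complex.exp_add, Complex.ofReal_exp, urot]
    congr 1
    push_cast
    ring_nf
  · rw [hgI, Polynomial.finsetSum_coeff]
    simp only [Polynomial.coeff_monomial, Finset.sum_ite_eq', Finset.mem_range]
    split_ifs with h
    · rfl
    · rw [Polynomial.coeff_eq_zero_of_natDegree_lt (by omega), Complex.zero_im, zero_div]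

/-! ## Part B. The engine: a witness with an irrational phase coefficient -/

/-- **Density from a ramified witness with an IRRATIONAL phase coefficient** (growth / Kronecker
dichotomy; no resonance, hence no transcendence hypothesis).  `S` irreducible closed of dimension
`≤ 2`; exponential points `q_j ∈ S` with `‖x₀(q_j)‖ → ∞` and `x₁(q_j) = Π(m₀ + j) + r(μ_j)`
(`r` analytic at `0`, `μ_j → 0`); if `Im Π_j / 2π` is irrational for some `j ≥ 1` then
`I(S ∩ Γ_exp) = I(S)`.  Proof = branches (a) and (c) of file II.
[cite: MantovaMasser2023, §1 Further remarks, p. 5 (the question, open in general)] (new) -/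
theorem unprojectedDense_of_witness_irrational_phase {S : Set (Fin 2 ⊕ Fin 2 → ℂ)}
    (hS : IsIrreducibleClosed ℂ S) (hdim : zariskiDim ℂ S ≤ (2 : ℕ))
    (Pl : Polynomial ℂ) (hirr : ∃ j, 1 ≤ j ∧ Irrational ((Pl.coeff j).im / (2 * Real.pi)))
    {r : ℂ → ℂ} (hr : AnalyticAt ℂ r 0) (m₀ : ℕ) {μ : ℕ → ℂ} (hμ : Tendsto μ atTop (𝓝 0))
    {q : ℕ → Fin 2 ⊕ Fin 2 → ℂ} (hqS : ∀ j, q j ∈ S) (hqΓ : ∀ j, q j ∈ expGraph ℂ 2)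
    (hnorm : Tendsto (fun j => ‖q j (Sum.inl 0)‖) atTop atTop)
    (hid₁ : ∀ j, q j (Sum.inl 1) = Pl.eval ((m₀ + j : ℕ) : ℂ) + r (μ j)) :
    UnprojectedDense S := by
  classical
  obtain ⟨gR, gI, hgR, hexpPK, hgIc⟩ := exists_re_im_polynomials_coeff Pl
  -- the witness `w = e^r`
  set w : ℂ → ℂ := fun u => Complex.exp (r u) with hw
  have hwan : AnalyticAt ℂ w 0 := hr.cexp
  have hw0 : ∀ u, w u ≠ 0 := fun u => Complex.exp_ne_zero _
  have hcast : ∀ j, ((m₀ + j : ℕ) : ℂ) = (((m₀ + j : ℕ) : ℝ) : ℂ) := fun j => by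
    rw [Complex.ofReal_natCast]
  -- `y₁ = e^{x₁}` on the exponential points
  have hexp₁ : ∀ j, q j (Sum.inr 1) = Complex.exp (q j (Sum.inl 1)) := fun j => by
    have h := (mem_expGraph_iff.1 (hqΓ j)) 1
    rw [h, Literature.ModelTheory.ExponentialFields.ExponentialRing.complex_exp_eq]
  have hid : ∀ j, q j (Sum.inr 1) =
      urot (gI.eval ((m₀ + j : ℕ) : ℝ)) *
        ((Real.exp (gR.eval ((m₀ + j : ℕ) : ℝ)) : ℂ) * w (μ j)) := by
    intro j
    rw [hexp₁ j, hid₁ j, Complex.exp_add, hcast, hexpPK]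
    ring
  have hwlim : Tendsto (fun m => w (μ m)) atTop (𝓝 (w 0)) := hwan.continuousAt.tendsto.comp hμ
  have hrlim : Tendsto (fun m => r (μ m)) atTop (𝓝 (r 0)) := hr.continuousAt.tendsto.comp hμ
  by_cases hgRdeg : 1 ≤ gR.natDegree
  · /- (a) GROWTH: some order of `Re x₁(q_j)` survives; THEOREM G -/
    have hre : ∀ m, (q m (Sum.inl 1)).re = gR.eval ((m₀ + m : ℕ) : ℝ) + (r (μ m)).re := by
      intro m
      rw [hid₁ m, Complex.add_re, hcast, hgR]
    obtain ⟨M, hM⟩ : ∃ M : ℝ, ∀ m, ‖r (μ m)‖ ≤ M := by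
      obtain ⟨C, hC⟩ := isBounded_iff_forall_norm_le.1 (Metric.isBounded_range_of_tendsto _ hrlim)
      exact ⟨C, fun m => hC _ ⟨m, rfl⟩⟩
    have hM0 : 0 ≤ M := (norm_nonneg _).trans (hM 0)
    have ha : ∀ m, |(q m (Sum.inl 1)).re - gR.eval ((m₀ + m : ℕ) : ℝ)| ≤ M := by
      intro m
      rw [hre m, add_sub_cancel_left]
      exact (Complex.abs_re_le_norm _).trans (hM m)
    obtain ⟨D, hD, hLD⟩ := log_two_add_norm_eval_le_log_label Pl (le_refl (0 : ℝ))
    have hLD' : ∀ m, Real.log (2 + ‖q m (Sum.inl 1)‖) ≤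
        (D + Real.log (1 + M)) * Real.log (3 + 3 * ((m₀ + m : ℕ) : ℝ)) := by
      intro m
      have hlab0 : (0 : ℝ) ≤ ((m₀ + m : ℕ) : ℝ) := Nat.cast_nonneg _
      have h1 : Real.log (2 + ‖Pl.eval ((m₀ + m : ℕ) : ℂ)‖) ≤
          D * Real.log (3 + 3 * ((m₀ + m : ℕ) : ℝ)) := by
        refine hLD _ _ hlab0 ?_
        rw [Complex.norm_natCast, zero_add]
        linarith
      have h2 : ‖q m (Sum.inl 1)‖ ≤ ‖Pl.eval ((m₀ + m : ℕ) : ℂ)‖ + M := by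
        rw [hid₁ m]
        exact (norm_add_le _ _).trans (by linarith [hM m])
      calc Real.log (2 + ‖q m (Sum.inl 1)‖)
          ≤ Real.log (2 + ‖Pl.eval ((m₀ + m : ℕ) : ℂ)‖ + M) :=
            Real.log_le_log (by positivity) (by linarith)
        _ ≤ (D + Real.log (1 + M)) * Real.log (3 + 3 * ((m₀ + m : ℕ) : ℝ)) :=
            log_two_add_add_le (norm_nonneg _) hM0 (one_le_log_three_add _ hlab0) h1
    have hD' : 0 < D + Real.log (1 + M) := by
      have := Real.log_nonneg (by linarith : (1 : ℝ) ≤ 1 + M)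
      linarith
    have hgr : Tendsto (fun m => |(q m (Sum.inl 1)).re| / Real.log (2 + ‖q m (Sum.inl 1)‖))
        atTop atTop :=
      tendsto_abs_div_log_of_linear_growth hgRdeg m₀ hD' ha
        (fun m => Real.log_le_log two_pos (by linarith [norm_nonneg (q m (Sum.inl 1))])) hLD'
    exact unprojectedDense_of_growth hS hdim 1 hqS hqΓ hgr
  · /- `g_R` is constant: the modulus of the phase factor is constant; (c) KRONECKER -/
    have hgR0 : gR.natDegree = 0 := by omega
    set r₀ : ℝ := gR.coeff 0 with hr₀
    have hgRev : ∀ x : ℝ, gR.eval x = r₀ := fun x => by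
      rw [Polynomial.eq_C_of_natDegree_eq_zero hgR0, Polynomial.eval_C]
    set c₀ : ℂ := ((Real.exp r₀ : ℝ) : ℂ) with hc₀
    have hc₀0 : c₀ ≠ 0 := by rw [hc₀]; exact_mod_cast (Real.exp_pos r₀).ne'
    have hid' : ∀ m, q m (Sum.inr 1) = urot (gI.eval ((m₀ + m : ℕ) : ℝ)) * (c₀ * w (μ m)) := by
      intro m; rw [hid m, hgRev]
    -- the phases do not accumulate at any finite set (an irrational coefficient of positive index)
    have hirr' : ∃ j, 1 ≤ j ∧ Irrational (gI.coeff j) := by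
      obtain ⟨j, hj, hj'⟩ := hirr
      exact ⟨j, hj, by rw [hgIc]; exact hj'⟩
    have hfar := urot_eval_not_near_finset gI hirr'
    by_contra hnot
    have hex : ∃ f, f ∈ vanishingIdeal ℂ (S ∩ expGraph ℂ 2) ∧ f ∉ vanishingIdeal ℂ S := by
      by_contra h
      push Not at h
      exact hnot (le_antisymm h (vanishingIdeal_anti_mono Set.inter_subset_left))
    obtain ⟨f, hfΓ, hfS⟩ := hex
    -- THEOREM H: one relation on all points
    obtain ⟨H, hH0, hH⟩ := exists_polyPoly_relation_of_forall_aeval_eq_zero hS hdim hqS hfS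
      (fun m => (mem_vanishingIdeal_iff.1 hfΓ) _ ⟨hqS m, hqΓ m⟩) (Sum.inl 0) (Sum.inr 1)
    set e : ℕ → ℂ := fun m => urot (gI.eval ((m₀ + m : ℕ) : ℝ)) with he
    have he1 : ∀ m, ‖e m‖ = 1 := fun m => norm_urot _
    have hrel : ∀ m, (H.map (Polynomial.evalRingHom (q m (Sum.inl 0)))).eval
        (e m * (c₀ * w (μ m))) = 0 := by
      intro m
      have h1 := hH m
      rwa [hid' m] at h1
    -- … so the phases accumulate at a finite set: contradiction
    have hwlim' : Tendsto (fun m => c₀ * w (μ m)) atTop (𝓝 (c₀ * w 0)) := hwlim.const_mul c₀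
    obtain ⟨F, hF⟩ := phases_near_finset_of_relation hH0 hnorm he1 (mul_ne_zero hc₀0 (hw0 0))
      hwlim' hrel
    obtain ⟨ε, hε, hfar'⟩ := hfar F
    obtain ⟨m₁, hm₁⟩ := Filter.eventually_atTop.1 (hF ε hε)
    obtain ⟨k', hk', hkfar⟩ := hfar' (m₀ + m₁)
    obtain ⟨ζ, hζF, hζ⟩ := hm₁ (k' - m₀) (by omega)
    have hkk : m₀ + (k' - m₀) = k' := by omega
    rw [he] at hζ
    simp only [hkk] at hζ
    exact absurd hζ (not_lt.2 (hkfar ζ hζF))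

/-! ## Part C. Cylinder germs along a place: irrational top phase -/

/-- **Irrational top phase ⟹ dense.**  A cylinder germ `(s^{-k}, Φ(s)s^{-M}, ψ(s), e^{x₁})`
(`k, M ≥ 1`, `ψ(0) = θ ≠ 0`) in an irreducible closed `S` of dimension `≤ 2`, with
`Im(Φ(0)·z^M)/2π` IRRATIONAL for SOME `k`-th root `z` of `2πi`, gives Zariski-dense exponential
points: the witness on the chart with tangent `z` (file XIX) has top phase coefficient
`Π_M = Φ(0)z^M` (file XIV), and Part B applies.  (If `Re(Φ(0)z^M) ≠ 0` this is growth, file XIX;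
the new case is a purely imaginary, non-resonant top phase.)
[cite: MantovaMasser2023, §1 Further remarks, p. 5 (the question, open in general)] (new) -/
theorem unprojectedDense_branch_of_irrational_phase {S : Set (Fin 2 ⊕ Fin 2 → ℂ)}
    (hS : IsIrreducibleClosed ℂ S) (hdim : zariskiDim ℂ S ≤ (2 : ℕ))
    {k M : ℕ} (hk : 1 ≤ k) (hM : 1 ≤ M) {ψ : ℂ → ℂ} (hψ : AnalyticAt ℂ ψ 0) {θ : ℂ} (hθ0 : θ ≠ 0)
    (hψ0 : ψ 0 = θ) {Φ : ℂ → ℂ} (hΦ : AnalyticAt ℂ Φ 0)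
    (hdir : ∃ z : ℂ, z ^ k = 2 * Real.pi * I ∧ Irrational ((Φ 0 * z ^ M).im / (2 * Real.pi)))
    (hgerm : ∀ᶠ s in 𝓝[≠] (0 : ℂ),
      (Sum.elim ![(s ^ k)⁻¹, Φ s * (s ^ M)⁻¹] ![ψ s, Complex.exp (Φ s * (s ^ M)⁻¹)] :
        Fin 2 ⊕ Fin 2 → ℂ) ∈ S) :
    UnprojectedDense S := by
  classical
  obtain ⟨z, hz, hzirr⟩ := hdir
  -- `θ = e^τ`; chart WITH TANGENT `z`; witness
  set τ : ℂ := Complex.log θ with hτdef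
  have hτ : Complex.exp τ = θ := Complex.exp_log hθ0
  obtain ⟨m, hman, hm0, hmz, hchart⟩ := exists_ramifiedChart_root hψ hθ0 hψ0 τ hk hz
  have h2πI : (2 * Real.pi * I : ℂ) ≠ 0 := by simp [Real.pi_ne_zero, Complex.I_ne_zero]
  have hm' : deriv m 0 ≠ 0 := by
    rw [hmz]
    rintro rfl
    rw [zero_pow (by omega)] at hz
    exact h2πI hz.symm
  obtain ⟨U, r, Pl, m₀, μ, σ, -, -, hran, hPldeg, -, hside, -, hμ, -, hGσ, -, hexpσ, hnorm,
      -, hid₁⟩ :=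
    exists_ramified_witness_branch hθ0 hτ hk hgerm hman hm0 hm' hchart hΦ M
  -- the leading coefficient `Π_M = Φ(0)·z^M`
  have hmne : ∀ᶠ s in 𝓝[≠] (0 : ℂ), m s ≠ 0 := by
    refine eventually_nhdsWithin_iff.2 ?_
    filter_upwards [hchart] with s hs hs0 using (hs.2.2.2.2 hs0).1
  have hcoeff : Pl.coeff M = Φ 0 * deriv m 0 ^ M :=
    laurentPart_coeff_eq hman hm0 hmne hΦ hM hPldeg hran (hside.mono fun s h => h.2)
  have hirr : ∃ j, 1 ≤ j ∧ Irrational ((Pl.coeff j).im / (2 * Real.pi)) :=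
    ⟨M, hM, by rw [hcoeff, hmz]; exact hzirr⟩
  -- the points
  set q : ℕ → Fin 2 ⊕ Fin 2 → ℂ := fun j =>
    Sum.elim ![(σ j ^ k)⁻¹, Φ (σ j) * (σ j ^ M)⁻¹]
      ![ψ (σ j), Complex.exp (Φ (σ j) * (σ j ^ M)⁻¹)] with hq
  have hqS : ∀ j, q j ∈ S := fun j => hGσ j
  have hqΓ : ∀ j, q j ∈ expGraph ℂ 2 := by
    intro j
    rw [mem_expGraph_iff]
    intro i
    rw [Literature.ModelTheory.ExponentialFields.ExponentialRing.complex_exp_eq]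
    fin_cases i
    · simp [hq, hexpσ j]
    · simp [hq]
  have hid : ∀ j, q j (Sum.inl 1) = Pl.eval ((m₀ + j : ℕ) : ℂ) + r (μ j) := fun j => by
    simp only [hq, Sum.elim_inl, Matrix.cons_val_one, Matrix.cons_val_zero]
    exact hid₁ j
  have hnorm' : Tendsto (fun j => ‖q j (Sum.inl 0)‖) atTop atTop := by
    refine hnorm.congr fun j => ?_
    simp [hq]
  exact unprojectedDense_of_witness_irrational_phase hS hdim Pl hirr hran m₀ hμ hqS hqΓ hnorm' hid

/-- **Resonance is the only obstruction at the top order.**  Dense as soon as, for SOME `k`-th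
root `z` of `2πi`, `Φ(0)z^M` has nonzero real part (growth, file XIX) or an imaginary part that is
an irrational multiple of `2π` (Kronecker, this file).
[cite: MantovaMasser2023, §1 Further remarks, p. 5 (the question, open in general)] (new) -/
theorem unprojectedDense_branch_of_not_resonant {S : Set (Fin 2 ⊕ Fin 2 → ℂ)}
    (hS : IsIrreducibleClosed ℂ S) (hdim : zariskiDim ℂ S ≤ (2 : ℕ))
    {k M : ℕ} (hk : 1 ≤ k) (hM : 1 ≤ M) {ψ : ℂ → ℂ} (hψ : AnalyticAt ℂ ψ 0) {θ : ℂ} (hθ0 : θ ≠ 0)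
    (hψ0 : ψ 0 = θ) {Φ : ℂ → ℂ} (hΦ : AnalyticAt ℂ Φ 0)
    (hdir : ∃ z : ℂ, z ^ k = 2 * Real.pi * I ∧
      ((Φ 0 * z ^ M).re ≠ 0 ∨ Irrational ((Φ 0 * z ^ M).im / (2 * Real.pi))))
    (hgerm : ∀ᶠ s in 𝓝[≠] (0 : ℂ),
      (Sum.elim ![(s ^ k)⁻¹, Φ s * (s ^ M)⁻¹] ![ψ s, Complex.exp (Φ s * (s ^ M)⁻¹)] :
        Fin 2 ⊕ Fin 2 → ℂ) ∈ S) :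
    UnprojectedDense S := by
  obtain ⟨z, hz, hre | him⟩ := hdir
  · exact unprojectedDense_branch_growth_of_exists_direction hS hdim hk hM hψ hθ0 hψ0 hΦ
      ⟨z, hz, hre⟩ hgerm
  · exact unprojectedDense_branch_of_irrational_phase hS hdim hk hM hψ hθ0 hψ0 hΦ ⟨z, hz, him⟩
      hgerm

/-- `Im(a·2πi)/2π = a` for real `a`. [folklore] -/
theorem im_ofReal_mul_two_pi_I_div (a : ℝ) :
    ((a : ℂ) * (2 * Real.pi * I)).im / (2 * Real.pi) = a := by
  have hπ : (2 * Real.pi : ℝ) ≠ 0 := by positivity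
  have h : ((a : ℂ) * (2 * Real.pi * I)).im = a * (2 * Real.pi) := by
    simp [Complex.mul_im, Complex.mul_re]
  rw [h, mul_div_assoc, div_self hπ, mul_one]

/-- **Equal pole orders, real IRRATIONAL direction, finite nonzero fibre value: dense — for every
ramification `k`.**  A cylinder germ `(s^{-k}, Φ(s)s^{-k}, ψ(s), e^{x₁})` (`k ≥ 1`, `ψ(0) = θ ≠ 0`,
`Φ(0) = a ∈ ℝ ∖ ℚ`) in an irreducible closed `S` of dimension `≤ 2` has `I(S ∩ Γ_exp) = I(S)`:
the top phase coefficient is `Π_k = a·z^k = 2πia`.  This is the regime where growth is void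
(`Re x₁ = a·Re x₀ + o(x₀)` along the branch).
[cite: MantovaMasser2023, §1 Further remarks, p. 5 (the question, open in general)] (new) -/
theorem unprojectedDense_branch_unitFibre_irrational {S : Set (Fin 2 ⊕ Fin 2 → ℂ)}
    (hS : IsIrreducibleClosed ℂ S) (hdim : zariskiDim ℂ S ≤ (2 : ℕ))
    {k : ℕ} (hk : 1 ≤ k) {ψ : ℂ → ℂ} (hψ : AnalyticAt ℂ ψ 0) {θ : ℂ} (hθ0 : θ ≠ 0)
    (hψ0 : ψ 0 = θ) {Φ : ℂ → ℂ} (hΦ : AnalyticAt ℂ Φ 0) {a : ℝ} (ha : Irrational a)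
    (hΦ0 : Φ 0 = a)
    (hgerm : ∀ᶠ s in 𝓝[≠] (0 : ℂ),
      (Sum.elim ![(s ^ k)⁻¹, Φ s * (s ^ k)⁻¹] ![ψ s, Complex.exp (Φ s * (s ^ k)⁻¹)] :
        Fin 2 ⊕ Fin 2 → ℂ) ∈ S) :
    UnprojectedDense S := by
  obtain ⟨z, hz⟩ := IsAlgClosed.exists_pow_nat_eq (2 * Real.pi * I : ℂ) (by omega : 0 < k)
  refine unprojectedDense_branch_of_irrational_phase hS hdim hk hk hψ hθ0 hψ0 hΦ ⟨z, hz, ?_⟩ hgerm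
  rw [hz, hΦ0, im_ofReal_mul_two_pi_I_div]
  exact ha

end Summit.Schanuel.Schanuel.Theorems

end
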